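import Summits.CriticalPhenomena.PercolationContinuityZ3.Theorems.PercNearOneGluingNoHeavyLowerTailPatternLightest
import Summits.CriticalPhenomena.PercolationContinuityZ3.Theorems.PercNearOneGluingNoHeavyLowerTailRankedSelection
import Literature.StrongHypotheses.CriticalPhenomena
import HarnessLib

/-!
# `NoHeavyLowerTail` (stmt-CriticalPhenomena-4575) — ONE selection principle behind PL-block, the averaged post-FKG
# inequality (⟹ Kozma–Nitzan Conj. 1) and the hull-port selection line: typed socket and calibration

Hull-port prover #4 (prim-hp-4 gen 7, LP-duality line), 2026-08-19.  `μ = prodBernoulli w` on `Fin n`; observer `o`;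
candidates `S`; a target alphabet `V ⊇ S` (`o ∉ V`); a MONOTONE target `𝒯` on subsets of `V`, read on relay patterns:
`𝒯(c) = {ω | 𝒯 (V.filter (c ↔ ·))}`, `t_c = μ(𝒯(c))`; a ranking `ρ` of `S` listing SMALLER `t` first, and the first-reached events
`E_c = {o ↔ c} ∩ {o ↮ c′ for c′ ranked before c}` (`W = c`).  THE SELECTION PRINCIPLE (SP) is the hypothesis

  `Σ_{c∈S} μ(E_c)·t_c ≤ Σ_{c∈S} μ(E_c ∩ 𝒯(c))`,  i.e.  `E[t_W ; o ↔ S] ≤ μ(o ↔ S, 𝒯(W))`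

("selecting the least promising reached candidate does not deflate its target probability").  INSTANCES: `𝒯 = (∋ b)` is the
averaged post-FKG inequality AVG (prim-gen-kcluster's covariance gluing (U), `stub_covGluing`); `𝒯 = (|·| > j)`, `S = V = A` is
the complement form of prim-hp-8's PL-block bound `stub_blockLightest`; `𝒯 = (a₁ ∈ · ∨ |· ∩ A| > j)` is the complement form of the
hull-port selection inequality (SO_ρ).  THEOREMS (tree): `|S| ≤ 2` for every target (`SelectionOrder.averagedPostFKG_pair_family`),
`𝒯 = (|· ∩ A| ≥ 2)` for every `S` (`selectionOrder_levelOne`, `blockLightest_levelOne`), constant `t` (`blockLightest_top`).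
Census (memo HULLPORT-LP-gen7.md §4): all 166 up-set targets on four letters, ≈1.5·10⁵ exact instances, 0 violations; only the
sorted order is valid.  HERE (no definitions, no sorries): the selection sum equals the block sum (`sum_first_eq_sum_blocks`);
(SP) ⟹ PL-block at every level (`blockLightest_of_selectionPrinciple`) ⟹ `NoHeavyLowerTail`
(`noHeavyLowerTail_of_selectionPrinciple`); and the calibration (SP) ⟹ Kozma–Nitzan's Conjecture 1
(`kozmaNitzan_conjecture1_of_selectionPrinciple`).
-/

noncomputable section

namespace Summit.CriticalPhenomena.PercolationContinuityZ3.Theorems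

open MeasureTheory Set Literature.Probability.LatticeModels Literature.Probability.Percolation
open scoped Classical BigOperators

namespace SelectionOrder

variable {n : ℕ}

/-- **Selection sum = block sum** for the pattern `π(o) = A.filter (o ↔ ·)`: for `ρ` injective on `A`, the `ρ`-argmin
selection `sel` and any weights `g`, `Σ_{b∈A} μ(E_b)·g b = Σ_{∅≠B⊆A} μ(π(o) = B)·g (sel B)`.
(Adapted from `CoinReduction.sum_sel_eq_sum_patterns`, the same identity for the attachment pattern.) [folklore] -/
theorem sum_first_eq_sum_blocks (μ : Measure (BondConfig (Fin n))) [IsFiniteMeasure μ] (A : Finset (Fin n)) (o : Fin n)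
    (ρ : Fin n → ℕ) (hρ : Set.InjOn ρ ↑A) (sel : Finset (Fin n) → Fin n)
    (hsel : ∀ B : Finset (Fin n), B.Nonempty → sel B ∈ B ∧ ∀ b ∈ B, ρ (sel B) ≤ ρ b) (g : Fin n → ℝ) :
    ∑ b ∈ A, μ.real (openConn o b ∩ {ω : BondConfig (Fin n) | ∀ c ∈ A, ρ c < ρ b → ω ∉ openConn o c}) * g b =
      ∑ B ∈ A.powerset.erase ∅, μ.real {ω : BondConfig (Fin n) | (A.filter fun x => ω ∈ openConn o x) = B} *
        g (sel B) := by
  set pat : BondConfig (Fin n) → Finset (Fin n) := fun ω => A.filter fun x => ω ∈ openConn o x with hpat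
  set Sel : Fin n → Set (BondConfig (Fin n)) := fun b =>
    openConn o b ∩ {ω : BondConfig (Fin n) | ∀ c ∈ A, ρ c < ρ b → ω ∉ openConn o c} with hSel
  set P := A.powerset.erase ∅ with hP
  have hmaps : ∀ B ∈ P, sel B ∈ A := by
    intro B hB
    have hBA : B ⊆ A := Finset.mem_powerset.1 (Finset.mem_of_mem_erase hB)
    have hBne : B.Nonempty := Finset.nonempty_iff_ne_empty.2 (Finset.ne_of_mem_erase hB)
    exact hBA (hsel B hBne).1
  have hfib : ∀ b ∈ A, μ.real (Sel b) = ∑ B ∈ P.filter (fun B => sel B = b), μ.real {ω | pat ω = B} := by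
    intro b hbA
    have hdisj : (↑(P.filter fun B => sel B = b) : Set (Finset (Fin n))).PairwiseDisjoint
        fun B => ({ω | pat ω = B} : Set (BondConfig (Fin n))) := by
      intro B₁ _ B₂ _ hne
      rw [Function.onFun, Set.disjoint_left]
      intro ω h1 h2
      exact hne (h1.symm.trans h2)
    rw [← measureReal_biUnion_finset hdisj (fun B _ => MeasurableSet.of_discrete)]
    congr 1
    ext ω
    simp only [hSel, mem_inter_iff, mem_setOf_eq, mem_iUnion, Finset.mem_filter, exists_prop]
    constructor
    · rintro ⟨hob, hall⟩
      have hb : b ∈ pat ω := Finset.mem_filter.2 ⟨hbA, hob⟩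
      have hne : (pat ω).Nonempty := ⟨b, hb⟩
      have hPm : pat ω ∈ P := by
        refine Finset.mem_erase.2 ⟨Finset.nonempty_iff_ne_empty.1 hne, Finset.mem_powerset.2 ?_⟩
        intro x hx; exact (Finset.mem_filter.1 hx).1
      refine ⟨pat ω, ⟨hPm, ?_⟩, rfl⟩
      obtain ⟨hs1, hs2⟩ := hsel (pat ω) hne
      have hsA : sel (pat ω) ∈ A := (Finset.mem_filter.1 hs1).1
      have h1 : ρ (sel (pat ω)) ≤ ρ b := hs2 b hb
      have h2 : ¬ ρ (sel (pat ω)) < ρ b := fun h => hall _ hsA h (Finset.mem_filter.1 hs1).2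
      exact hρ (Finset.mem_coe.2 hsA) (Finset.mem_coe.2 hbA) (le_antisymm h1 (not_lt.1 h2))
    · rintro ⟨B, ⟨hBP, hselB⟩, hpatB⟩
      have hBne : B.Nonempty := Finset.nonempty_iff_ne_empty.2 (Finset.ne_of_mem_erase hBP)
      obtain ⟨hs1, hs2⟩ := hsel B hBne
      rw [hselB] at hs1 hs2
      rw [← hpatB] at hs1 hs2
      refine ⟨(Finset.mem_filter.1 hs1).2, fun c hcA hlt hoc => ?_⟩
      exact absurd (hs2 c (Finset.mem_filter.2 ⟨hcA, hoc⟩)) (not_le.2 hlt)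
  calc ∑ b ∈ A, μ.real (Sel b) * g b
      = ∑ b ∈ A, ∑ B ∈ P.filter (fun B => sel B = b), μ.real {ω | pat ω = B} * g b := by
        apply Finset.sum_congr rfl
        intro b hb
        rw [hfib b hb, Finset.sum_mul]
    _ = ∑ b ∈ A, ∑ B ∈ P.filter (fun B => sel B = b), μ.real {ω | pat ω = B} * g (sel B) := by
        apply Finset.sum_congr rfl
        intro b _
        apply Finset.sum_congr rfl
        intro B hB
        rw [(Finset.mem_filter.1 hB).2]
    _ = ∑ B ∈ P, μ.real {ω | pat ω = B} * g (sel B) :=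
        Finset.sum_fiberwise_of_maps_to (g := sel) (fun B hB => hmaps B hB) _

/-- On `{o ↔ A}` some relay of `A` is reached first: `⋃_{c∈A} E_c = {o ↔ A}`, and the `E_c` are pairwise disjoint for an
injective ranking; hence `Σ_{c∈A} μ(E_c) = μ(o ↔ A)`. [folklore] -/
theorem sum_real_first_eq (μ : Measure (BondConfig (Fin n))) [IsFiniteMeasure μ] (A : Finset (Fin n)) (o : Fin n)
    (ρ : Fin n → ℕ) (hρ : Set.InjOn ρ ↑A) :
    ∑ c ∈ A, μ.real (openConn o c ∩ {ω : BondConfig (Fin n) | ∀ c' ∈ A, ρ c' < ρ c → ω ∉ openConn o c'}) =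
      μ.real (⋃ a ∈ A, (openConn o a : Set (BondConfig (Fin n)))) := by
  have hdisj : (↑A : Set (Fin n)).PairwiseDisjoint fun c =>
      openConn o c ∩ {ω : BondConfig (Fin n) | ∀ c' ∈ A, ρ c' < ρ c → ω ∉ openConn o c'} := by
    intro b hb b' hb' hne
    simp only [Function.onFun]
    refine Set.disjoint_left.2 fun ω hω hω' => ?_
    obtain ⟨hob, hmin⟩ := hω
    obtain ⟨hob', hmin'⟩ := hω'
    have hne' : ρ b ≠ ρ b' := fun h => hne (hρ hb hb' h)
    rcases lt_or_gt_of_ne hne' with h | h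
    · exact hmin' b (Finset.mem_coe.1 hb) h hob
    · exact hmin b' (Finset.mem_coe.1 hb') h hob'
  rw [← measureReal_biUnion_finset hdisj (fun c _ => MeasurableSet.of_discrete)]
  congr 1
  ext ω
  simp only [mem_iUnion, mem_inter_iff, mem_setOf_eq, exists_prop]
  constructor
  · rintro ⟨c, hc, hoc, _⟩
    exact ⟨c, hc, hoc⟩
  · rintro ⟨c, hc, hoc⟩
    obtain ⟨b, hb, hbmin⟩ := Finset.exists_min_image (A.filter fun x => ω ∈ openConn o x) ρ
      ⟨c, Finset.mem_filter.2 ⟨hc, hoc⟩⟩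
    obtain ⟨hbA, hob⟩ := Finset.mem_filter.1 hb
    refine ⟨b, hbA, hob, fun c' hc' hlt hoc' => ?_⟩
    have := hbmin c' (Finset.mem_filter.2 ⟨hc', hoc'⟩)
    omega

/-- **(SP) ⟹ PL-block at every level** (the registered stub `stub_blockLightest`, verbatim shape).  Apply the selection
principle with `S = V = A` and the monotone target `|T| > j` ("heavy"), ranking relays of larger lightness probability
first; pass to complements (`light = ¬heavy`); cover `{1 ≤ N ≤ j}` by the events `E_c ∩ {|π(c)| ≤ j}`; rewrite the
selection sum as the block sum. [this work] -/
theorem blockLightest_of_selectionPrinciple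
    (hSP : ∀ (n : ℕ) (w : Sym2 (Fin n) → unitInterval) (S V : Finset (Fin n)) (o : Fin n)
      (𝒯 : Finset (Fin n) → Prop) (ρ : Fin n → ℕ), S ⊆ V → o ∉ V → (∀ T T' : Finset (Fin n), T ⊆ T' → 𝒯 T → 𝒯 T') →
      Set.InjOn ρ ↑S →
      (∀ b ∈ S, ∀ c ∈ S, ρ c < ρ b →
        (prodBernoulli w).real {ω : BondConfig (Fin n) | 𝒯 (V.filter fun x => ω ∈ openConn c x)} ≤
          (prodBernoulli w).real {ω : BondConfig (Fin n) | 𝒯 (V.filter fun x => ω ∈ openConn b x)}) →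
      ∑ c ∈ S, (prodBernoulli w).real
          (openConn o c ∩ {ω : BondConfig (Fin n) | ∀ c' ∈ S, ρ c' < ρ c → ω ∉ openConn o c'}) *
        (prodBernoulli w).real {ω : BondConfig (Fin n) | 𝒯 (V.filter fun x => ω ∈ openConn c x)} ≤
      ∑ c ∈ S, (prodBernoulli w).real
          ((openConn o c ∩ {ω : BondConfig (Fin n) | ∀ c' ∈ S, ρ c' < ρ c → ω ∉ openConn o c'}) ∩
            {ω : BondConfig (Fin n) | 𝒯 (V.filter fun x => ω ∈ openConn c x)})) :
    ∀ (n : ℕ) (w : Sym2 (Fin n) → unitInterval) (A : Finset (Fin n)) (o : Fin n) (j : ℕ), o ∉ A →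
      ∃ sel : Finset (Fin n) → Fin n, (∀ B ∈ A.powerset.erase ∅, sel B ∈ B) ∧
        (prodBernoulli w).real {ω : BondConfig (Fin n) |
            1 ≤ (A.filter fun x => ω ∈ openConn o x).card ∧ (A.filter fun x => ω ∈ openConn o x).card ≤ j} ≤
          ∑ B ∈ A.powerset.erase ∅,
            (prodBernoulli w).real {ω : BondConfig (Fin n) | (A.filter fun x => ω ∈ openConn o x) = B} *
              (prodBernoulli w).real {ω : BondConfig (Fin n) | (A.filter fun x => ω ∈ openConn (sel B) x).card ≤ j} := by
  intro n w A o j ho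
  set μ := prodBernoulli w with hμ
  set light : Fin n → Set (BondConfig (Fin n)) := fun c =>
    {ω | (A.filter fun x => ω ∈ openConn c x).card ≤ j} with hlight
  set heavy : Fin n → Set (BondConfig (Fin n)) := fun c =>
    {ω | j < (A.filter fun x => ω ∈ openConn c x).card} with hheavy
  set g : Fin n → ℝ := fun c => μ.real (light c) with hg
  -- rank by decreasing lightness probability; select the first relay of each block
  obtain ⟨ρ, hρ, hmono⟩ := CoinReduction.exists_compatible_ranking g A
  set sel : Finset (Fin n) → Fin n := fun B =>
    if h : B.Nonempty then Classical.choose (Finset.exists_min_image B ρ h) else o with hseldef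
  have hsel : ∀ B : Finset (Fin n), B.Nonempty → sel B ∈ B ∧ ∀ b ∈ B, ρ (sel B) ≤ ρ b := by
    intro B hB
    have hspec := Classical.choose_spec (Finset.exists_min_image B ρ hB)
    simp only [hseldef, dif_pos hB]
    exact ⟨hspec.1, hspec.2⟩
  have hselmem : ∀ B ∈ A.powerset.erase ∅, sel B ∈ B := fun B hB =>
    (hsel B (Finset.nonempty_iff_ne_empty.2 (Finset.ne_of_mem_erase hB))).1
  refine ⟨sel, hselmem, ?_⟩
  set E : Fin n → Set (BondConfig (Fin n)) := fun c =>
    openConn o c ∩ {ω : BondConfig (Fin n) | ∀ c' ∈ A, ρ c' < ρ c → ω ∉ openConn o c'} with hE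
  -- complements: `μ(heavy c) = 1 - g c`, `μ(E_c ∩ light c) = μ(E_c) - μ(E_c ∩ heavy c)`
  have hcompl : ∀ c, heavy c = (light c)ᶜ := by
    intro c; ext ω; simp [hheavy, hlight, not_le]
  have hheavy_real : ∀ c, μ.real (heavy c) = 1 - g c := by
    intro c; rw [hcompl c]; exact probReal_compl_eq_one_sub MeasurableSet.of_discrete
  have hsplitE : ∀ c, μ.real (E c ∩ light c) = μ.real (E c) - μ.real (E c ∩ heavy c) := by
    intro c
    rw [← measureReal_inter_add_sdiff (s := E c) (MeasurableSet.of_discrete : MeasurableSet (light c)),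
      Set.sdiff_eq, ← hcompl c]
    ring
  -- the selection principle for the heavy target
  have hSPA := hSP n w A A o (fun T => j < T.card) ρ (subset_refl A) ho
    (fun T T' hTT' hT => lt_of_lt_of_le hT (Finset.card_le_card hTT')) hρ
    (by
      intro b hb c hc hlt
      have h1 : g b ≤ g c := hmono c hc b hb hlt
      have hb' := hheavy_real b
      have hc' := hheavy_real c
      simp only [hheavy] at hb' hc'
      linarith)
  change ∑ c ∈ A, μ.real (E c) * μ.real (heavy c) ≤ ∑ c ∈ A, μ.real (E c ∩ heavy c) at hSPA
  -- (1) cover: `{1 ≤ N ≤ j} ⊆ ⋃_c (E_c ∩ light c)`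
  have hcover : {ω : BondConfig (Fin n) |
        1 ≤ (A.filter fun x => ω ∈ openConn o x).card ∧ (A.filter fun x => ω ∈ openConn o x).card ≤ j} ⊆
      ⋃ c ∈ A, (E c ∩ light c) := by
    intro ω hω
    obtain ⟨h1, h2⟩ := hω
    obtain ⟨b, hb, hbmin⟩ := Finset.exists_min_image (A.filter fun x => ω ∈ openConn o x) ρ (Finset.card_pos.1 h1)
    obtain ⟨hbA, hob⟩ := Finset.mem_filter.1 hb
    refine mem_iUnion₂.2 ⟨b, hbA, ⟨hob, fun c' hc' hlt hoc' => ?_⟩, ?_⟩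
    · have := hbmin c' (Finset.mem_filter.2 ⟨hc', hoc'⟩)
      omega
    · have heq : (A.filter fun x => ω ∈ openConn b x) = (A.filter fun x => ω ∈ openConn o x) := by
        apply Finset.filter_congr
        intro x _
        exact ⟨fun hbx => (hob : (openGraph ω).Reachable o b).trans hbx,
          fun hox => (hob : (openGraph ω).Reachable o b).symm.trans hox⟩
      simp only [hlight, mem_setOf_eq, heq]
      exact h2
  have hstep1 : μ.real {ω : BondConfig (Fin n) |
        1 ≤ (A.filter fun x => ω ∈ openConn o x).card ∧ (A.filter fun x => ω ∈ openConn o x).card ≤ j} ≤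
      ∑ c ∈ A, μ.real (E c ∩ light c) :=
    (measureReal_mono hcover (measure_ne_top μ _)).trans (measureReal_biUnion_finset_le _ _)
  -- (2) the principle, in complement form
  have hstep2 : ∑ c ∈ A, μ.real (E c ∩ light c) ≤ ∑ c ∈ A, μ.real (E c) * g c := by
    have h1 : ∑ c ∈ A, μ.real (E c ∩ light c) = ∑ c ∈ A, μ.real (E c) - ∑ c ∈ A, μ.real (E c ∩ heavy c) := by
      rw [← Finset.sum_sub_distrib]; exact Finset.sum_congr rfl fun c _ => hsplitE c
    have h2 : ∑ c ∈ A, μ.real (E c) * g c = ∑ c ∈ A, μ.real (E c) - ∑ c ∈ A, μ.real (E c) * μ.real (heavy c) := by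
      rw [← Finset.sum_sub_distrib]
      exact Finset.sum_congr rfl fun c _ => by rw [hheavy_real c]; ring
    rw [h1, h2]
    linarith
  -- (3) selection sum = block sum
  have hstep3 := sum_first_eq_sum_blocks μ A o ρ hρ sel hsel g
  calc μ.real {ω : BondConfig (Fin n) |
          1 ≤ (A.filter fun x => ω ∈ openConn o x).card ∧ (A.filter fun x => ω ∈ openConn o x).card ≤ j}
      ≤ ∑ c ∈ A, μ.real (E c ∩ light c) := hstep1
    _ ≤ ∑ c ∈ A, μ.real (E c) * g c := hstep2
    _ = _ := hstep3

/-- **(SP) ⟹ `NoHeavyLowerTail`** (through PL-block and the landed `noHeavyLowerTail_of_blockLightest`). [this work] -/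
theorem noHeavyLowerTail_of_selectionPrinciple
    (hSP : ∀ (n : ℕ) (w : Sym2 (Fin n) → unitInterval) (S V : Finset (Fin n)) (o : Fin n)
      (𝒯 : Finset (Fin n) → Prop) (ρ : Fin n → ℕ), S ⊆ V → o ∉ V → (∀ T T' : Finset (Fin n), T ⊆ T' → 𝒯 T → 𝒯 T') →
      Set.InjOn ρ ↑S →
      (∀ b ∈ S, ∀ c ∈ S, ρ c < ρ b →
        (prodBernoulli w).real {ω : BondConfig (Fin n) | 𝒯 (V.filter fun x => ω ∈ openConn c x)} ≤
          (prodBernoulli w).real {ω : BondConfig (Fin n) | 𝒯 (V.filter fun x => ω ∈ openConn b x)}) →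
      ∑ c ∈ S, (prodBernoulli w).real
          (openConn o c ∩ {ω : BondConfig (Fin n) | ∀ c' ∈ S, ρ c' < ρ c → ω ∉ openConn o c'}) *
        (prodBernoulli w).real {ω : BondConfig (Fin n) | 𝒯 (V.filter fun x => ω ∈ openConn c x)} ≤
      ∑ c ∈ S, (prodBernoulli w).real
          ((openConn o c ∩ {ω : BondConfig (Fin n) | ∀ c' ∈ S, ρ c' < ρ c → ω ∉ openConn o c'}) ∩
            {ω : BondConfig (Fin n) | 𝒯 (V.filter fun x => ω ∈ openConn c x)})) :
    Summit.CriticalPhenomena.PercolationContinuityZ3.Theses.PercNearOneGluing.NoHeavyLowerTail :=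
  PatternLightest.noHeavyLowerTail_of_blockLightest (blockLightest_of_selectionPrinciple hSP)

/-- **Calibration: (SP) ⟹ Kozma–Nitzan's Conjecture 1** (`μ(o ↔ A)·t ≤ μ(o ↔ b)` whenever `t ≤ μ(a ↔ b)` for all
`a ∈ A`): apply the principle with `S = A`, `V = A ∪ {b}` and the monotone target `b ∈ T`, ranking LESS reliable relays
first; `Σ_c μ(E_c) = μ(o ↔ A)` and `Σ_c μ(E_c ∩ {c ↔ b}) ≤ μ(o ↔ b)` (disjoint events inside `{o ↔ b}`).  So the selection
principle sits above KN's open Conjecture 1 (as its instance AVG already does). [cite: KozmaNitzan2024, Conjecture 1 (p. 3)] -/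
theorem kozmaNitzan_conjecture1_of_selectionPrinciple
    (hSP : ∀ (n : ℕ) (w : Sym2 (Fin n) → unitInterval) (S V : Finset (Fin n)) (o : Fin n)
      (𝒯 : Finset (Fin n) → Prop) (ρ : Fin n → ℕ), S ⊆ V → o ∉ V → (∀ T T' : Finset (Fin n), T ⊆ T' → 𝒯 T → 𝒯 T') →
      Set.InjOn ρ ↑S →
      (∀ b ∈ S, ∀ c ∈ S, ρ c < ρ b →
        (prodBernoulli w).real {ω : BondConfig (Fin n) | 𝒯 (V.filter fun x => ω ∈ openConn c x)} ≤
          (prodBernoulli w).real {ω : BondConfig (Fin n) | 𝒯 (V.filter fun x => ω ∈ openConn b x)}) →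
      ∑ c ∈ S, (prodBernoulli w).real
          (openConn o c ∩ {ω : BondConfig (Fin n) | ∀ c' ∈ S, ρ c' < ρ c → ω ∉ openConn o c'}) *
        (prodBernoulli w).real {ω : BondConfig (Fin n) | 𝒯 (V.filter fun x => ω ∈ openConn c x)} ≤
      ∑ c ∈ S, (prodBernoulli w).real
          ((openConn o c ∩ {ω : BondConfig (Fin n) | ∀ c' ∈ S, ρ c' < ρ c → ω ∉ openConn o c'}) ∩
            {ω : BondConfig (Fin n) | 𝒯 (V.filter fun x => ω ∈ openConn c x)})) :
    Literature.StrongHypotheses.CriticalPhenomena.KozmaNitzan2024_conjecture1 := by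
  intro n w A o b t ht
  set μ := prodBernoulli w with hμ
  -- degenerate cases: `t ≤ 0`, `o ∈ A`, `o = b`
  by_cases ht0 : t ≤ 0
  · exact le_trans (mul_nonpos_of_nonneg_of_nonpos measureReal_nonneg ht0) measureReal_nonneg
  have htpos : 0 < t := lt_of_not_ge ht0
  have hU1 : μ.real (⋃ a ∈ A, (openConn o a : Set (BondConfig (Fin n)))) ≤ 1 := measureReal_le_one
  by_cases hoA : o ∈ A
  · calc μ.real (⋃ a ∈ A, (openConn o a : Set (BondConfig (Fin n)))) * t ≤ 1 * t :=
          mul_le_mul_of_nonneg_right hU1 htpos.le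
      _ ≤ μ.real (openConn o b) := by rw [one_mul]; exact ht o hoA
  by_cases hob : o = b
  · subst hob
    have h1 : μ.real (openConn o o : Set (BondConfig (Fin n))) = 1 := by
      have : (openConn o o : Set (BondConfig (Fin n))) = univ :=
        Set.eq_univ_of_forall fun ω => (SimpleGraph.Reachable.refl o : (openGraph ω).Reachable o o)
      rw [this, probReal_univ]
    rw [h1]
    by_cases hA : A.Nonempty
    · obtain ⟨a, ha⟩ := hA
      calc μ.real (⋃ a ∈ A, (openConn o a : Set (BondConfig (Fin n)))) * t ≤ 1 * t :=
            mul_le_mul_of_nonneg_right hU1 htpos.le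
        _ ≤ 1 := by rw [one_mul]; exact (ht a ha).trans measureReal_le_one
    · rw [Finset.not_nonempty_iff_eq_empty.1 hA]
      simp
  -- main case: the principle with `S = A`, `V = insert b A`, target `b ∈ T`
  set V := insert b A with hV
  have hoV : o ∉ V := by
    rw [hV, Finset.mem_insert]; push Not; exact ⟨hob, hoA⟩
  set p : Fin n → ℝ := fun c => μ.real (openConn c b : Set (BondConfig (Fin n))) with hp
  -- ranking: smaller `p` first (= larger `-p` first)
  obtain ⟨ρ, hρ, hmono⟩ := CoinReduction.exists_compatible_ranking (fun c => - p c) A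
  have htarget : ∀ c ∈ A, {ω : BondConfig (Fin n) | b ∈ V.filter fun x => ω ∈ openConn c x} = openConn c b := by
    intro c _
    ext ω
    simp only [mem_setOf_eq, Finset.mem_filter, hV, Finset.mem_insert, true_or, true_and]
  have hSPA := hSP n w A V o (fun T => b ∈ T) ρ (by rw [hV]; exact Finset.subset_insert b A) hoV
    (fun T T' hTT' hT => hTT' hT) hρ
    (by
      intro x hx c hc hlt
      rw [htarget c hc, htarget x hx]
      have := hmono c hc x hx hlt
      simp only [neg_le_neg_iff] at this
      exact this)
  set E : Fin n → Set (BondConfig (Fin n)) := fun c =>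
    openConn o c ∩ {ω : BondConfig (Fin n) | ∀ c' ∈ A, ρ c' < ρ c → ω ∉ openConn o c'} with hE
  have hL : ∑ c ∈ A, μ.real (E c) * μ.real {ω : BondConfig (Fin n) | b ∈ V.filter fun x => ω ∈ openConn c x} =
      ∑ c ∈ A, μ.real (E c) * p c :=
    Finset.sum_congr rfl fun c hc => by rw [htarget c hc]
  have hR : ∑ c ∈ A, μ.real (E c ∩ {ω : BondConfig (Fin n) | b ∈ V.filter fun x => ω ∈ openConn c x}) =
      ∑ c ∈ A, μ.real (E c ∩ openConn c b) :=
    Finset.sum_congr rfl fun c hc => by rw [htarget c hc]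
  change ∑ c ∈ A, μ.real (E c) * μ.real {ω : BondConfig (Fin n) | b ∈ V.filter fun x => ω ∈ openConn c x} ≤
    ∑ c ∈ A, μ.real (E c ∩ {ω : BondConfig (Fin n) | b ∈ V.filter fun x => ω ∈ openConn c x}) at hSPA
  rw [hL, hR] at hSPA
  -- `Σ_c μ(E_c) = μ(o ↔ A)` and `Σ_c μ(E_c ∩ {c ↔ b}) ≤ μ(o ↔ b)`
  have hsumE := sum_real_first_eq μ A o ρ hρ
  have hdisj : (↑A : Set (Fin n)).PairwiseDisjoint fun c => E c ∩ openConn c b := by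
    intro c hc c' hc' hne
    simp only [Function.onFun]
    refine Set.disjoint_left.2 fun ω hω hω' => ?_
    obtain ⟨⟨hoc, hmin⟩, _⟩ := hω
    obtain ⟨⟨hoc', hmin'⟩, _⟩ := hω'
    have hne' : ρ c ≠ ρ c' := fun h => hne (hρ hc hc' h)
    rcases lt_or_gt_of_ne hne' with h | h
    · exact hmin' c (Finset.mem_coe.1 hc) h hoc
    · exact hmin c' (Finset.mem_coe.1 hc') h hoc'
  have hsumB : ∑ c ∈ A, μ.real (E c ∩ openConn c b) ≤ μ.real (openConn o b : Set (BondConfig (Fin n))) := by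
    rw [← measureReal_biUnion_finset hdisj (fun c _ => MeasurableSet.of_discrete)]
    refine measureReal_mono (Set.iUnion₂_subset fun c _ => ?_)
    rintro ω ⟨⟨hoc, _⟩, hcb⟩
    exact (hoc : (openGraph ω).Reachable o c).trans hcb
  have hlow : ∑ c ∈ A, μ.real (E c) * t ≤ ∑ c ∈ A, μ.real (E c) * p c :=
    Finset.sum_le_sum fun c hc => mul_le_mul_of_nonneg_left (ht c hc) measureReal_nonneg
  rw [← Finset.sum_mul, hsumE] at hlow
  linarith

end SelectionOrder

end Summit.CriticalPhenomena.PercolationContinuityZ3.Theorems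

end
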